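import Literature.NumberTheory.EllipticCurves.IwasawaAlgebraProofs
import Mathlib.LinearAlgebra.Isomorphisms
import Mathlib.RingTheory.QuotSMulTop
import HarnessLib

/-!
# Route `SignedLowerHalves`, crux L `SmallImageLowerHalfBothSigns` (item stmt-BirchSwinnertonDyer-23599), line `rtt_w3` v13 — E2, road D
# («detdescent», BRIEF-E2 rev 2.1 §6): the DESCENT BOOKKEEPING in characteristic-ideal currency, generic over a Noetherian domain —
# (B1) the lever `(M ⧸ R∙z)[f] = 0`, (B2) the double-quotient swap, (B3) `char(H ⧸ ∙z_θ) = char(P ⧸ ∙z̄) · char(K)` along the descent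
# sequence `0 → P → H → K → 0`, (B4) the assembly `char(𝐇¹_cyc ⧸ ∙z_θ) = char(𝐇²_cyc)`

Width seat `bsd-line-slh-p3-w3` g19 under LEAD `cruxlead-stmt-BirchSwinnertonDyer-23599` g9 (cell `bsd-ssimc`); ROUTE-INDEPENDENT helper
(`--supports stmt-BirchSwinnertonDyer-23599`); THEOREMS ONLY — no definition, no named fact, no instance, no `sorry`; pure module algebra; the
descent sequences, the zeta elements and JLK's equality are HYPOTHESES here (nothing cohomological is constructed or asserted); closes nothing;
BSD is not proved by any of this.

WHY. Road D reads E2-K off Johnson-Leung–Kings' two-variable equality `char_{Λ₂} A = char_{Λ₂} B` (`A = H¹₂/Z₂`, `B = H²₂`) by specialising along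
`f = (1+T₂) − u`: the λ-specialisation lemma is landed (`…RttD2LambdaSpecialisation[O]`, p775239/p775349: `char(A/f)·char(B[f]) = char(B/f)·char(A[f])`
over `𝒪⟦T⟧`), and the remaining algebra of the crux idea «detdescent» (cruxidea lineage, `Ideas/detdescent.md`, Sketch B1/B2) is: (B1) the
`f`-torsion of `A = H¹₂/Λ₂z` VANISHES as soon as `H¹₂[f] = 0` and `z` is not `f`-torsion modulo `fH¹₂` (= `z_θ ≠ 0` in the torsion-free
`𝐇¹_cyc`, Rohrlich) — no structure theorem; (B2) `(H¹₂/f)/∙z̄ ≅ A/fA`; (B3) along the Fukaya–Kato / JLK Lemma 4.4 descent sequence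
`0 → H¹₂/f →ⁱ 𝐇¹_cyc →ʲ H²₂[f] → 0` one has `char(𝐇¹_cyc/∙z_θ) = char((H¹₂/f)/∙z̄) · char(H²₂[f])` (`z_θ = i z̄`); (B4) with
`𝐇²_cyc ≅ H²₂/f` (`H³₂ = 0`) and the specialisation identity: `char(𝐇¹_cyc/∙z_θ) = char(𝐇²_cyc)`. All four are proved here for abstract
modules over a commutative (resp. Noetherian integral) ring, the sequences entering as exactness hypotheses — so they apply verbatim to whatever
carriers row D2-seq pins, over `ℤ_p⟦T⟧` or `𝒪⟦T⟧`.

* §1 ★ `torsionBy_quotient_span_eq_bot_of_lever` (B1; adapted from `HOME/cruxidea-stmt-BirchSwinnertonDyer-23599-1/Sketch-detdescent.lean` B1/B1′,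
  kernel-checked there, not importable).
* §2 `nonempty_quotSMulTop_quotient_span_linearEquiv` (B2: `(M/fM)/∙z̄ ≃ (M/∙z)/f(M/∙z)`, both `= M/(fM + Rz)`).
* §3 ★★ `charIdeal_quotient_span_eq_mul_of_exact` (B3: for `0 → P →ⁱ H →ʲ K → 0` exact and `z ∈ P` with `H/∙(i z)` finitely generated torsion:
  `char(H/∙i z) = char(P/∙z) · char(K)`).
* §4 ★ `charIdeal_descent_assembly` (B4: the ideal bookkeeping `char(𝐇¹/∙z_θ) = char(𝐇²)` from (B3), `char(𝐇²) = char(B/f)`, the specialisation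
  identity and `char(A[f]) = 1`).

References: [JohnsonLeungKings2011] §4.2, Lemma 4.4, Cor. 5.3; [FukayaKato2006] Prop. 1.6.5 (3); [BourbakiAC5to7] VII §4.5 Prop. 10;
[RohrlichInventiones1984] p. 383.
-/

set_option autoImplicit false
-- the Theorems namespace of this sub repeats the summit name by design (D-0017 nested layout)
set_option linter.dupNamespace false

noncomputable section

open scoped Pointwise

open Literature.NumberTheory.EllipticCurves Literature.NumberTheory.EllipticCurves.Module

namespace Summit.BirchSwinnertonDyer.BirchSwinnertonDyer.Theorems.SmallImageRttD2Descent

/-! ## §1. (B1) The lever: `(M ⧸ R∙z)[f] = 0` without any structure theorem -/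

section Lever

variable {R : Type*} [CommRing R] {M : Type*} [AddCommGroup M] [Module R M] (f : R) (z : M)

/-- (B1, elementwise) If `M` has no `f`-torsion and `a•z ∈ fM ⇒ f ∣ a`, then every `x` with `f•x ∈ R∙z` lies in `R∙z`.
[cite: JohnsonLeungKings2011, §4.2, Lemma 4.4] -/
theorem mem_span_singleton_of_smul_mem_of_lever (hM : ∀ x : M, f • x = 0 → x = 0) (hz : ∀ (a : R) (y : M), a • z = f • y → f ∣ a)
    (x : M) (hx : f • x ∈ Submodule.span R {z}) : x ∈ Submodule.span R {z} := by
  -- adapted from HOME/cruxidea-stmt-BirchSwinnertonDyer-23599-1/Sketch-detdescent.lean (B1)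
  obtain ⟨a, ha⟩ := Submodule.mem_span_singleton.mp hx
  obtain ⟨b, rfl⟩ := hz a x ha
  refine Submodule.mem_span_singleton.mpr ⟨b, ?_⟩
  have h0 : f • (x - b • z) = 0 := by rw [smul_sub, ← ha, mul_smul, sub_self]
  have := hM _ h0
  rw [sub_eq_zero] at this
  exact this.symm

/-- ★ **(B1) The lever.** If `M` has no `f`-torsion and the class of `z` in `M/fM` is `R/f`-torsion-free (`a•z ∈ fM ⇒ f ∣ a`), then
`(M ⧸ R∙z)[f] = 0`. Road D: `M = H¹₂` (`H¹₂[f_ξ] = 0`), `z` the zeta generator, `f = f_ξ`; the hypothesis on `z` is «`z_θ ≠ 0` in the torsion-free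
`𝐇¹_cyc`» (Rohrlich). So the descent defect `A[f_ξ]`, `A = H¹₂/Z₂`, vanishes with no «no pseudo-null submodule» input.
[cite: JohnsonLeungKings2011, §4.2, Lemma 4.4] [cite: RohrlichInventiones1984, p. 383] -/
theorem torsionBy_quotient_span_eq_bot_of_lever (hM : ∀ x : M, f • x = 0 → x = 0)
    (hz : ∀ (a : R) (y : M), a • z = f • y → f ∣ a) :
    Submodule.torsionBy R (M ⧸ Submodule.span R {z}) f = ⊥ := by
  -- adapted from HOME/cruxidea-stmt-BirchSwinnertonDyer-23599-1/Sketch-detdescent.lean (B1′)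
  rw [eq_bot_iff]
  intro q hq
  rw [Submodule.mem_torsionBy_iff] at hq
  induction q using Submodule.Quotient.induction_on with
  | H x =>
    rw [Submodule.mem_bot, Submodule.Quotient.mk_eq_zero]
    apply mem_span_singleton_of_smul_mem_of_lever f z hM hz x
    rw [← Submodule.Quotient.mk_eq_zero, Submodule.Quotient.mk_smul]
    exact hq

end Lever

/-! ## §2. (B2) The double-quotient swap `(M/fM)/∙z̄ ≃ (M/∙z)/f` -/

section Swap

variable {R : Type*} [CommRing R] {M : Type*} [AddCommGroup M] [Module R M] (f : R) (z : M)

/-- **(B2)** `(M ⧸ fM) ⧸ R∙z̄ ≃ₗ[R] (M ⧸ R∙z) ⧸ f(M ⧸ R∙z)` — both are `M ⧸ (fM + R∙z)`. Road D: `(H¹₂/f)/∙z̄ = A/fA` for `A = H¹₂/Λ₂z`.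
[cite: BourbakiAC5to7, VII §4.5] -/
theorem nonempty_quotSMulTop_quotient_span_linearEquiv :
    Nonempty (((QuotSMulTop f M) ⧸ Submodule.span R {Submodule.Quotient.mk (p := f • (⊤ : Submodule R M)) z}) ≃ₗ[R]
      QuotSMulTop f (M ⧸ Submodule.span R {z})) := by
  -- left: `(M/fM)/(∙z).map mkQ ≃ M/(fM ⊔ ∙z)`
  have hL : Submodule.span R {Submodule.Quotient.mk (p := f • (⊤ : Submodule R M)) z} =
      (Submodule.span R {z}).map (f • (⊤ : Submodule R M)).mkQ := by
    rw [Submodule.map_span, Set.image_singleton, Submodule.mkQ_apply]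
  -- right: `f • ⊤` in `M/∙z` is `(f • ⊤).map mkQ`
  have hR : (f • (⊤ : Submodule R (M ⧸ Submodule.span R {z}))) = (f • (⊤ : Submodule R M)).map (Submodule.span R {z}).mkQ := by
    rw [Submodule.map_pointwise_smul, Submodule.map_top, Submodule.range_mkQ]
  refine ⟨(Submodule.quotEquivOfEq _ _ hL).trans ((Submodule.quotientQuotientEquivQuotientSup _ _).trans
    ((Submodule.quotEquivOfEq _ _ (sup_comm _ _)).trans
      ((Submodule.quotientQuotientEquivQuotientSup _ _).symm.trans (Submodule.quotEquivOfEq _ _ hR.symm))))⟩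

end Swap

/-! ## §3. (B3) Characteristic ideals along the descent sequence -/

section Descent

variable {S : Type*} [CommRing S] [IsNoetherianRing S] [IsDomain S]
  {P H K : Type*} [AddCommGroup P] [Module S P] [AddCommGroup H] [Module S H] [AddCommGroup K] [Module S K]

/-- ★★ **(B3) `char(H ⧸ ∙i z) = char(P ⧸ ∙z) · char(K)`** for an exact `0 → P →ⁱ H →ʲ K → 0` of `S`-modules (`S` a Noetherian domain), `z ∈ P`,
with `H ⧸ S∙(i z)` finitely generated and torsion: the induced `0 → P/∙z → H/∙(i z) → K → 0` is exact and `char` is multiplicative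
(`Module.charIdeal_eq_mul_of_exact`). Road D: `P = H¹₂/f`, `H = 𝐇¹_cyc`, `K = H²₂[f]`, `i z̄ = z_θ` (Fukaya–Kato 1.6.5(3) / JLK Lemma 4.4 as the
hypothesis), so `char(𝐇¹_cyc/∙z_θ) = char(A/fA)·char(B[f])`. [cite: FukayaKato2006, Prop. 1.6.5 (3)] [cite: JohnsonLeungKings2011, Lemma 4.4]
[cite: BourbakiAC5to7, VII §4.5 Prop. 10] -/
theorem charIdeal_quotient_span_eq_mul_of_exact (i : P →ₗ[S] H) (j : H →ₗ[S] K) (hi : Function.Injective i)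
    (hj : Function.Surjective j) (hij : Function.Exact i j) (z : P)
    [Module.Finite S (H ⧸ Submodule.span S {i z})] (htors : Module.IsTorsion S (H ⧸ Submodule.span S {i z})) :
    charIdeal S (H ⧸ Submodule.span S {i z}) = charIdeal S (P ⧸ Submodule.span S {z}) * charIdeal S K := by
  -- the induced maps
  have hle : Submodule.span S {z} ≤ (Submodule.span S {i z}).comap i := by
    rw [Submodule.span_singleton_le_iff_mem, Submodule.mem_comap]
    exact Submodule.mem_span_singleton_self _
  have hker : Submodule.span S {i z} ≤ LinearMap.ker j := by
    rw [Submodule.span_singleton_le_iff_mem, LinearMap.mem_ker]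
    exact hij.apply_apply_eq_zero z
  let i' : (P ⧸ Submodule.span S {z}) →ₗ[S] (H ⧸ Submodule.span S {i z}) := Submodule.mapQ _ _ i hle
  let j' : (H ⧸ Submodule.span S {i z}) →ₗ[S] K := Submodule.liftQ _ j hker
  have hi' : Function.Injective i' := by
    rw [← LinearMap.ker_eq_bot, eq_bot_iff]
    intro x hx
    induction x using Submodule.Quotient.induction_on with
    | H y =>
      rw [LinearMap.mem_ker, Submodule.mapQ_apply, Submodule.Quotient.mk_eq_zero, Submodule.mem_span_singleton] at hx
      obtain ⟨a, ha⟩ := hx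
      rw [Submodule.mem_bot, Submodule.Quotient.mk_eq_zero, Submodule.mem_span_singleton]
      exact ⟨a, hi (by rw [map_smul, ha])⟩
  have hj' : Function.Surjective j' := fun k ↦ by
    obtain ⟨h, rfl⟩ := hj k
    exact ⟨Submodule.Quotient.mk h, by rw [Submodule.liftQ_apply]⟩
  have hexact : Function.Exact i' j' := by
    rw [LinearMap.exact_iff]
    apply le_antisymm
    · intro x hx
      induction x using Submodule.Quotient.induction_on with
      | H h =>
        rw [LinearMap.mem_ker, Submodule.liftQ_apply] at hx
        obtain ⟨y, rfl⟩ := (hij h).mp hx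
        exact ⟨Submodule.Quotient.mk y, by rw [Submodule.mapQ_apply]⟩
    · rintro x ⟨y, rfl⟩
      induction y using Submodule.Quotient.induction_on with
      | H q =>
        rw [LinearMap.mem_ker, Submodule.mapQ_apply, Submodule.liftQ_apply]
        exact hij.apply_apply_eq_zero q
  exact charIdeal_eq_mul_of_exact htors i' j' hi' hj' hexact

end Descent

/-! ## §4. (B4) The assembly -/

/-- ★ **(B4) Road D's ideal bookkeeping.** In any commutative semiring of ideals: from (B3) `c₁ = qA · tB` (`c₁ = char(𝐇¹_cyc/∙z_θ)`,
`qA = char(A/fA)`, `tB = char(B[f])`), `c₂ = qB` (`char(𝐇²_cyc) = char(B/fB)`, `H³₂ = 0`), the specialisation identity `qA · tB = qB · tA`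
(`…RttD2LambdaSpecialisationO.charIdeal_quotSMulTop_mul_eq_of_charIdeal_eq`, from JLK `char A = char B`) and the lever `tA = 1` ((B1), `A[f] = 0`):
`c₁ = c₂`, i.e. `char(𝐇¹_cyc/∙z_θ) = char(𝐇²_cyc)` — E2-K on the `θ`-line as an EQUALITY of characteristic ideals.
[cite: JohnsonLeungKings2011, Cor. 5.3, Lemma 4.4] -/
theorem charIdeal_descent_assembly {R' : Type*} [CommSemiring R'] {c₁ c₂ qA qB tA tB : R'}
    (h1 : c₁ = qA * tB) (h2 : c₂ = qB) (hspec : qA * tB = qB * tA) (hlever : tA = 1) : c₁ = c₂ := by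
  -- adapted from HOME/cruxidea-stmt-BirchSwinnertonDyer-23599-1/Sketch-detdescent.lean (B2)
  rw [h1, hspec, hlever, mul_one, h2]

end Summit.BirchSwinnertonDyer.BirchSwinnertonDyer.Theorems.SmallImageRttD2Descent

end
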